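import Mathlib.Analysis.SpecialFunctions.Trigonometric.Bounds
import Mathlib.Analysis.SpecialFunctions.Complex.Log
import Mathlib.Analysis.Real.Pi.Bounds
import Mathlib.Algebra.Field.GeomSum
import Literature.Computability.Cryptography.ShorProofs
import HarnessLib

/-!
# Shor's factoring theorem: discharge of the exponential-sum estimate `P(c, x^k) ≥ 1/3r²`

Sibling proofs file of `Literature/Computability/Cryptography/ShorProofs.lean` (which stays a
definitions/named-facts file). It discharges the named fact
`Literature.Computability.Cryptography.Shor1997_outcomeProb_lower_bound` (Shor 1997, §5, p. 14 of arXiv v2: "the probability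
of seeing a given state `|c, x^k (mod n)⟩` will thus be at least `1/3r²` if
`-r/2 ≤ {rc}_q ≤ r/2`", "for sufficiently large `n`"), as
`Literature.Computability.Cryptography.Shor1997_outcomeProb_lower_bound_holds`, with the explicit threshold `n ≥ 40`.

The printed argument: the sum in `Shor1997.outcomeProb` is a finite geometric series with ratio
`exp(2πi {rc}_q / q)`; when `|{rc}_q| ≤ r/2` the phases `2π b {rc}_q / q`,
`0 ≤ b ≤ ⌊(q-k-1)/r⌋`, stay in an arc of length `≤ π (1 + O(1/n))`, so the sum has modulus at
least `(2/π)(1 - O(1/n))` times the number `≈ q/r` of its terms, and the probability is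
`≥ (4/π²)(1/r²)(1 - O(1/n)) ≥ 1/3r²` for `n` large ("asymptotically `4/π²`", Shor, loc. cit.).
Below this is carried out with explicit constants: with `L = (2/π)(n-1)/(n+1)` one has
`‖∑_b z^b‖ ≥ L · B` (`B` the number of terms, via `‖z^B - 1‖ = 2 |sin(Bθ/2)|`,
`‖z - 1‖ ≤ |θ|` and the sinc bound `sin u ≥ L u` on `[0, π/2 + π/2n]`,
`Shor1997.OutcomeBound.sinc_lower`), `B/q ≥ (n-1)/(n r)`, and `12 (n-1)⁴ ≥ π² (n+1)² n²` for
`n ≥ 40` (`Shor1997.OutcomeBound.key_numeric`), whence the bound with `n₀ = 40`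
(`Shor1997.OutcomeBound.le_outcomeProb`).

## References

* P. W. Shor, *Polynomial-time algorithms for prime factorization and discrete logarithms on a
  quantum computer*, SIAM J. Comput. 26 (1997) 1484–1509 (= arXiv:quant-ph/9508027v2), §5,
  p. 14 of the arXiv version (the display after "this leaves us with the expression" and the
  paragraph ending "at least `1/3r²`") [Shor1997].

## Mathlib

Used: `geom_sum_eq`, `Complex.norm_exp_I_mul_ofReal_sub_one` (`‖e^{ix} - 1‖ = |2 sin(x/2)|`),
`Real.norm_exp_I_mul_ofReal_sub_one_le` (`‖e^{ix} - 1‖ ≤ ‖x‖`), `Real.mul_le_sin` (Jordan's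
inequality), `Real.pi_lt_d2` (`π < 3.15`), `Complex.exp_eq_one_iff`.
-/

noncomputable section

namespace Literature.Computability.Cryptography

open _root_.Computability Nat Complexity

namespace Shor1997.OutcomeBound

section OutcomeProb

open Finset

/-- A sinc-type lower bound slightly beyond `π/2`: for `N ≥ 1` and
`0 ≤ u ≤ π/2 + π/(2N)`, `sin u ≥ (2/π) ((N-1)/(N+1)) u` (Jordan's inequality `sin u ≥ 2u/π` on
`[0, π/2]`, reflected through `π/2` on the short extra arc). [folklore] -/
theorem sinc_lower {N u : ℝ} (hN : 1 ≤ N) (hu0 : 0 ≤ u)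
    (hu : u ≤ Real.pi / 2 + Real.pi / (2 * N)) :
    2 / Real.pi * ((N - 1) / (N + 1)) * u ≤ Real.sin u := by
  have hpi := Real.pi_pos
  have hN0 : 0 < N := by linarith
  have hfrac : (N - 1) / (N + 1) ≤ 1 := by
    rw [div_le_one (by linarith)]; linarith
  have hfrac0 : 0 ≤ (N - 1) / (N + 1) := div_nonneg (by linarith) (by linarith)
  rcases le_or_gt u (Real.pi / 2) with h | h
  · calc 2 / Real.pi * ((N - 1) / (N + 1)) * u ≤ 2 / Real.pi * 1 * u := by
          gcongr
      _ = 2 / Real.pi * u := by ring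
      _ ≤ Real.sin u := Real.mul_le_sin hu0 h
  · -- `u = π - v` with `v ∈ [π/2 - π/(2N), π/2)`
    have hv0 : 0 ≤ Real.pi - u := by
      have : Real.pi / (2 * N) ≤ Real.pi / 2 :=
        div_le_div_of_nonneg_left hpi.le (by norm_num) (by linarith)
      linarith
    have hv1 : Real.pi - u ≤ Real.pi / 2 := by linarith
    have hsin : 2 / Real.pi * (Real.pi - u) ≤ Real.sin u := by
      rw [← Real.sin_pi_sub]; exact Real.mul_le_sin hv0 hv1
    -- `2/π (π - u) ≥ 1 - 1/N` and `u ≤ (π/2)(N+1)/N`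
    have h1 : 1 - 1 / N ≤ 2 / Real.pi * (Real.pi - u) := by
      have : 2 / Real.pi * (Real.pi - u) ≥ 2 / Real.pi * (Real.pi / 2 - Real.pi / (2 * N)) :=
        mul_le_mul_of_nonneg_left (by linarith) (by positivity)
      have h' : 2 / Real.pi * (Real.pi / 2 - Real.pi / (2 * N)) = 1 - 1 / N := by
        field_simp
      linarith
    have h2 : 2 / Real.pi * ((N - 1) / (N + 1)) * u ≤ 1 - 1 / N := by
      have hu' : u ≤ Real.pi / 2 * ((N + 1) / N) := by
        have : Real.pi / 2 + Real.pi / (2 * N) = Real.pi / 2 * ((N + 1) / N) := by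
          field_simp
        linarith
      calc 2 / Real.pi * ((N - 1) / (N + 1)) * u
          ≤ 2 / Real.pi * ((N - 1) / (N + 1)) * (Real.pi / 2 * ((N + 1) / N)) := by
            gcongr
        _ = 1 - 1 / N := by
            field_simp
    linarith

/-- `|sin x| = |sin |x||`. [folklore] -/
theorem abs_sin_eq_abs_sin_abs (x : ℝ) : |Real.sin x| = |Real.sin (|x|)| := by
  rcases abs_choice x with h | h
  · rw [h]
  · rw [h, Real.sin_neg, abs_neg]

/-- The numerical constant of the `1/3r²` bound: for `N ≥ 40`,
`1/3 ≤ ((2/π) ((N-1)/(N+1)) ((N-1)/N))²` (i.e. `π² (N+1)² N² ≤ 12 (N-1)⁴`; uses `π < 3.15`).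
Shor: "at least `1/3r²` for sufficiently large `n`" — asymptotically the constant is `4/π²`.
[cite: Shor1997, §5 (bound 1/3r^2 for |{rc}_q| ≤ r/2)] -/
theorem key_numeric {N : ℝ} (hN : 40 ≤ N) :
    1 / 3 ≤ (2 / Real.pi * ((N - 1) / (N + 1)) * ((N - 1) / N)) ^ 2 := by
  have hpi := Real.pi_pos
  have hpi3 : Real.pi < 3.15 := Real.pi_lt_d2
  have hN0 : 0 < N := by linarith
  have hexpr : (2 / Real.pi * ((N - 1) / (N + 1)) * ((N - 1) / N)) ^ 2 =
      4 * (N - 1) ^ 4 / (Real.pi ^ 2 * ((N + 1) ^ 2 * N ^ 2)) := by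
    field_simp
    ring
  rw [hexpr, div_le_div_iff₀ (by norm_num) (by positivity)]
  -- `π² (n+1)² n² ≤ 10 (n+1)² n² ≤ 12 (n-1)^4`
  have hpi2 : Real.pi ^ 2 ≤ 10 := by nlinarith
  obtain ⟨t, ht, rfl⟩ : ∃ t, 0 ≤ t ∧ N = t + 40 := ⟨N - 40, by linarith, by ring⟩
  have hpoly : 10 * ((t + 40 + 1) ^ 2 * (t + 40) ^ 2) ≤ 12 * (t + 40 - 1) ^ 4 := by
    nlinarith [sq_nonneg t, mul_nonneg ht (sq_nonneg t), pow_nonneg ht 3, pow_nonneg ht 4]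
  calc 1 * (Real.pi ^ 2 * ((t + 40 + 1) ^ 2 * (t + 40) ^ 2))
      ≤ 10 * ((t + 40 + 1) ^ 2 * (t + 40) ^ 2) := by
        rw [one_mul]; exact mul_le_mul_of_nonneg_right hpi2 (by positivity)
    _ ≤ 12 * (t + 40 - 1) ^ 4 := hpoly
    _ = 4 * (t + 40 - 1) ^ 4 * 3 := by ring

/-- **The geometric-sum estimate** behind Shor's `1/3r²` bound (Shor 1997, §5, p. 14 of
arXiv v2): if `0 < |θ| < 2π` and the `B` phases `0, θ, …, (B-1)θ` span an arc
`B|θ| ≤ π + π/N` (`N ≥ 1`), then `‖∑_{b<B} e^{ibθ}‖ ≥ (2/π) ((N-1)/(N+1)) B`. Proof: the sum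
is `(e^{iBθ} - 1)/(e^{iθ} - 1)`, of modulus `2 |sin(Bθ/2)| / ‖e^{iθ} - 1‖ ≥ 2 sin(B|θ|/2) / |θ|`,
and `sin u ≥ (2/π)((N-1)/(N+1)) u` on `[0, π/2 + π/2N]` (`sinc_lower`).
[cite: Shor1997, §5 (bound 1/3r^2 for |{rc}_q| ≤ r/2)] -/
theorem norm_geom_sum_exp_ge {θ N : ℝ} {B : ℕ} (hN : 1 ≤ N) (hθ0 : θ ≠ 0)
    (hθπ : |θ| < 2 * Real.pi) (hB : B * |θ| / 2 ≤ Real.pi / 2 + Real.pi / (2 * N)) :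
    2 / Real.pi * ((N - 1) / (N + 1)) * B ≤
      ‖∑ b ∈ range B, Complex.exp (Complex.I * (θ : ℂ)) ^ b‖ := by
  have hpi := Real.pi_pos
  set L : ℝ := 2 / Real.pi * ((N - 1) / (N + 1)) with hL
  -- `exp (iθ) ≠ 1` since `0 < |θ| < 2π`
  have hz : Complex.exp (Complex.I * (θ : ℂ)) ≠ 1 := by
    intro h
    obtain ⟨m, hm⟩ := Complex.exp_eq_one_iff.mp h
    have hθm : θ = 2 * Real.pi * m := by
      have h1 : Complex.I * (θ : ℂ) = Complex.I * ((2 * Real.pi * m : ℝ) : ℂ) := by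
        rw [hm]; push_cast; ring
      exact_mod_cast mul_left_cancel₀ Complex.I_ne_zero h1
    rcases eq_or_ne m 0 with hm0 | hm0
    · apply hθ0; rw [hθm, hm0]; simp
    · have h4 : 2 * Real.pi ≤ |θ| := by
        rw [hθm, abs_mul, abs_of_pos (by positivity : (0 : ℝ) < 2 * Real.pi)]
        have : (1 : ℝ) ≤ |(m : ℝ)| := by exact_mod_cast Int.one_le_abs hm0
        nlinarith
      linarith
  rw [geom_sum_eq hz, norm_div]
  -- numerator and denominator
  have hnum : ‖Complex.exp (Complex.I * (θ : ℂ)) ^ B - 1‖ = |2 * Real.sin (B * θ / 2)| := by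
    rw [← Complex.exp_nat_mul]
    have : (B : ℂ) * (Complex.I * (θ : ℂ)) = Complex.I * ((B * θ : ℝ) : ℂ) := by
      push_cast; ring
    rw [this, Complex.norm_exp_I_mul_ofReal_sub_one, Real.norm_eq_abs]
  have hden : ‖Complex.exp (Complex.I * (θ : ℂ)) - 1‖ ≤ |θ| := by
    rw [← Real.norm_eq_abs]; exact Real.norm_exp_I_mul_ofReal_sub_one_le
  have hden0 : 0 < ‖Complex.exp (Complex.I * (θ : ℂ)) - 1‖ :=
    norm_pos_iff.mpr (sub_ne_zero.mpr hz)
  -- `u = B |θ| / 2 ∈ [0, π/2 + π/(2N)] ⊆ [0, π]`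
  set u : ℝ := B * |θ| / 2 with hu
  have hu0 : 0 ≤ u := by positivity
  have hupi : u ≤ Real.pi := by
    have : Real.pi / (2 * N) ≤ Real.pi / 2 :=
      div_le_div_of_nonneg_left hpi.le (by norm_num) (by linarith)
    linarith
  have hsin0 : 0 ≤ Real.sin u := Real.sin_nonneg_of_nonneg_of_le_pi hu0 hupi
  have hsinu : |2 * Real.sin (B * θ / 2)| = 2 * Real.sin u := by
    rw [abs_mul, abs_two, abs_sin_eq_abs_sin_abs]
    have : |(B : ℝ) * θ / 2| = u := by
      simp only [hu, abs_div, abs_mul, Nat.abs_cast, abs_two]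
    rw [this, abs_of_nonneg hsin0]
  have hsinc : L * u ≤ Real.sin u := sinc_lower hN hu0 hB
  -- assemble: `‖S‖ = 2 sin u / ‖z - 1‖ ≥ 2 sin u / |θ| ≥ 2 L u / |θ| = L B`
  have habsθ0 : 0 < |θ| := abs_pos.mpr hθ0
  have hLB : L * B = 2 * (L * u) / |θ| := by
    rw [hu]; field_simp
  rw [hLB, hnum, hsinu]
  calc 2 * (L * u) / |θ| ≤ 2 * Real.sin u / |θ| := by
        gcongr
    _ ≤ 2 * Real.sin u / ‖Complex.exp (Complex.I * (θ : ℂ)) - 1‖ :=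
        div_le_div_of_nonneg_left (by positivity) hden0 hden

/-- **Shor's `1/3r²` estimate, explicit form** (Shor 1997, §5, p. 14 of arXiv v2): for
`n ≥ 40`, `n² ≤ q`, `0 < r < n`, `k < r` and `|{rc}_q| ≤ r/2`, the probability
`outcomeProb q r k c` of observing `|c, x^k mod n⟩` is at least `1/3r²`. (The printed
hypotheses `q < 2n²`, `q` a power of `2` and `c < q` are not needed for this inequality.)
[cite: Shor1997, §5 (bound 1/3r^2 for |{rc}_q| ≤ r/2)] -/
theorem le_outcomeProb {n q r k c : ℕ} (hn : 40 ≤ n) (hq : n ^ 2 ≤ q) (hr : 0 < r)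
    (hrn : r < n) (hkr : k < r) (hs : 2 * |Shor1997.symmMod (r * c) q| ≤ r) :
    1 / (3 * (r : ℝ) ^ 2) ≤ Shor1997.outcomeProb q r k c := by
  unfold Shor1997.outcomeProb
  -- real casts of the parameters
  have hpi := Real.pi_pos
  have hn40 : (40 : ℝ) ≤ n := by exact_mod_cast hn
  have hn0 : (0 : ℝ) < n := by linarith
  have hr0 : (0 : ℝ) < r := by exact_mod_cast hr
  have hrn' : (r : ℝ) < n := by exact_mod_cast hrn
  have hqn : (n : ℝ) ^ 2 ≤ q := by exact_mod_cast hq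
  have hq0 : (0 : ℝ) < q := lt_of_lt_of_le (by positivity) hqn
  have hrq0 : (r : ℝ) < q := by
    calc (r : ℝ) < n := hrn'
      _ ≤ n ^ 2 := by nlinarith
      _ ≤ q := hqn
  have hrq : (r : ℝ) / q ≤ 1 / n := by
    rw [div_le_div_iff₀ hq0 hn0]; nlinarith
  set s : ℤ := Shor1997.symmMod (r * c) q with hs_def
  have hs' : 2 * |(s : ℝ)| ≤ r := by
    have : ((2 * |s| : ℤ) : ℝ) ≤ ((r : ℤ) : ℝ) := by exact_mod_cast hs
    simpa using this
  set B : ℕ := (q - k - 1) / r + 1 with hB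
  -- (F1) `q - r < r B` and (F2) `r B ≤ q + r`
  have hF1 : (q : ℝ) - r < r * B := by
    have h1 : q - k - 1 < r * B := by
      have := Nat.lt_div_mul_add (a := q - k - 1) hr
      simpa [hB, mul_add, mul_comm] using this
    have h2 : q - r ≤ q - k - 1 := by omega
    have h3 : ((q - r : ℕ) : ℝ) < r * B := by exact_mod_cast lt_of_le_of_lt h2 h1
    have h4 : ((q - r : ℕ) : ℝ) = (q : ℝ) - r := by
      rw [Nat.cast_sub]; nlinarith
    linarith
  have hF2 : (r : ℝ) * B ≤ q + r := by
    have h1 : r * ((q - k - 1) / r) ≤ q - k - 1 := Nat.mul_div_le _ _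
    have h2 : r * B ≤ q + r := by
      simp only [hB, mul_add, mul_one]; omega
    exact_mod_cast h2
  have hB0 : (0 : ℝ) < B := by
    have : (0 : ℝ) < r * B := by nlinarith
    nlinarith
  -- the sum as a geometric sum with ratio `exp (iθ)`, `θ = 2π s / q`
  set θ : ℝ := 2 * Real.pi * (s : ℝ) / q with hθ
  have hterm : ∀ b ∈ range B,
      Complex.exp (2 * Real.pi * Complex.I * (b : ℂ) * (s : ℂ) / (q : ℂ)) =
        Complex.exp (Complex.I * (θ : ℂ)) ^ b := by
    intro b _
    rw [← Complex.exp_nat_mul]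
    congr 1
    simp only [hθ]; push_cast; ring
  rw [sum_congr rfl hterm]
  set L : ℝ := 2 / Real.pi * (((n : ℝ) - 1) / (n + 1)) with hL
  have hL0 : 0 ≤ L :=
    mul_nonneg (div_nonneg zero_le_two hpi.le) (div_nonneg (by linarith) (by linarith))
  have hL1 : L ≤ 1 := by
    have h1 : 2 / Real.pi ≤ 1 := by
      rw [div_le_one hpi]; linarith [Real.pi_gt_three]
    have h2 : ((n : ℝ) - 1) / (n + 1) ≤ 1 := by
      rw [div_le_one (by linarith)]; linarith
    calc L = 2 / Real.pi * (((n : ℝ) - 1) / (n + 1)) := rfl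
      _ ≤ 1 * 1 := mul_le_mul h1 h2 (div_nonneg (by linarith) (by linarith)) zero_le_one
      _ = 1 := one_mul 1
  -- **the amplitude bound** `‖S‖ ≥ L B`
  have hS : L * B ≤ ‖∑ b ∈ range B, Complex.exp (Complex.I * (θ : ℂ)) ^ b‖ := by
    by_cases hs0 : s = 0
    · -- all terms are `1`
      have hθ0 : θ = 0 := by simp [hθ, hs0]
      rw [hθ0, Complex.ofReal_zero, mul_zero, Complex.exp_zero]
      simp only [one_pow, sum_const, card_range, nsmul_eq_mul, mul_one, Complex.norm_natCast]
      exact mul_le_of_le_one_left (Nat.cast_nonneg B) hL1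
    · -- genuine geometric sum: `norm_geom_sum_exp_ge` with `N = n`
      have hsR : (s : ℝ) ≠ 0 := by exact_mod_cast hs0
      have hθ0 : θ ≠ 0 :=
        div_ne_zero (mul_ne_zero (mul_ne_zero two_ne_zero hpi.ne') hsR) hq0.ne'
      have habsθ : |θ| = 2 * Real.pi * |(s : ℝ)| / q := by
        simp only [hθ, abs_div, abs_mul, abs_of_pos hpi, abs_of_pos hq0, abs_two]
      have hθπ : |θ| < 2 * Real.pi := by
        rw [habsθ, div_lt_iff₀ hq0]
        nlinarith
      have hule : B * |θ| / 2 ≤ Real.pi / 2 + Real.pi / (2 * n) := by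
        have h1 : B * |θ| / 2 = Real.pi * (|(s : ℝ)| * B / q) := by
          simp only [habsθ]; ring
        have h2 : |(s : ℝ)| * B / q ≤ (1 + r / q) / 2 := by
          rw [div_le_iff₀ hq0]
          have h5 : |(s : ℝ)| * B ≤ r / 2 * B := by nlinarith
          have h6 : (1 + (r : ℝ) / q) / 2 * q = (q + r) / 2 := by field_simp
          rw [h6]; linarith
        have h3 : (1 + (r : ℝ) / q) / 2 ≤ (1 + 1 / n) / 2 := by linarith
        have h7 : Real.pi * ((1 + 1 / (n : ℝ)) / 2) = Real.pi / 2 + Real.pi / (2 * n) := by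
          field_simp
        rw [h1, ← h7]
        exact mul_le_mul_of_nonneg_left (h2.trans h3) hpi.le
      exact norm_geom_sum_exp_ge (le_trans (by norm_num) hn40) hθ0 hθπ hule
  -- from the amplitude bound to the probability bound
  have hA : L * (((n : ℝ) - 1) / n) / r ≤
      ‖(1 / (q : ℂ)) * ∑ b ∈ range B, Complex.exp (Complex.I * (θ : ℂ)) ^ b‖ := by
    rw [norm_mul, norm_div, norm_one, Complex.norm_natCast]
    have hBq : ((n : ℝ) - 1) / n / r ≤ B / q := by
      rw [div_div, div_le_div_iff₀ (by positivity) hq0]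
      have hnr : (n : ℝ) * r ≤ q :=
        calc (n : ℝ) * r ≤ n * n := mul_le_mul_of_nonneg_left hrn'.le hn0.le
          _ = (n : ℝ) ^ 2 := by ring
          _ ≤ q := hqn
      have h5 : (n : ℝ) * (q - r) ≤ n * (r * B) := mul_le_mul_of_nonneg_left hF1.le hn0.le
      have h6 : ((n : ℝ) - 1) * q ≤ n * (q - r) := by linarith
      have h7 : (n : ℝ) * (r * B) = B * (n * r) := by ring
      linarith
    calc L * (((n : ℝ) - 1) / n) / r = L * (((n : ℝ) - 1) / n / r) := by ring
      _ ≤ L * (B / q) := mul_le_mul_of_nonneg_left hBq hL0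
      _ = 1 / q * (L * B) := by ring
      _ ≤ 1 / q * ‖∑ b ∈ range B, Complex.exp (Complex.I * (θ : ℂ)) ^ b‖ :=
        mul_le_mul_of_nonneg_left hS (by positivity)
  have h1n : (0 : ℝ) ≤ n - 1 := sub_nonneg.mpr (le_trans (by norm_num) hn40)
  have hM0 : 0 ≤ L * (((n : ℝ) - 1) / n) := mul_nonneg hL0 (div_nonneg h1n hn0.le)
  -- (no `linarith` below this point: the square in `hM` slows its preprocessing down)
  have hM : 1 / 3 ≤ (L * (((n : ℝ) - 1) / n)) ^ 2 := by
    have := key_numeric hn40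
    rwa [← hL] at this
  calc 1 / (3 * (r : ℝ) ^ 2) = 1 / 3 / r ^ 2 := by rw [div_div]
    _ ≤ (L * (((n : ℝ) - 1) / n)) ^ 2 / r ^ 2 := by gcongr
    _ = (L * (((n : ℝ) - 1) / n) / r) ^ 2 := by rw [div_pow]
    _ ≤ ‖(1 / (q : ℂ)) * ∑ b ∈ range B, Complex.exp (Complex.I * (θ : ℂ)) ^ b‖ ^ 2 :=
        pow_le_pow_left₀ (div_nonneg hM0 hr0.le) hA 2

end OutcomeProb

end Shor1997.OutcomeBound

/-- **Discharge of Shor's exponential-sum estimate** `Shor1997_outcomeProb_lower_bound`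
(Shor 1997, §5, p. 14 of arXiv v2), with `n₀ = 40`: from `Shor1997.OutcomeBound.le_outcomeProb`.
[cite: Shor1997, §5 (bound 1/3r^2 for |{rc}_q| ≤ r/2)] -/
theorem Shor1997_outcomeProb_lower_bound_holds : Shor1997_outcomeProb_lower_bound :=
  ⟨40, fun _ _ _ _ _ hn hq _ _ hr hrn hkr _ hs =>
    Shor1997.OutcomeBound.le_outcomeProb hn hq hr hrn hkr hs⟩

end Literature.Computability.Cryptography

end
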